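import Summits.HodgeConjecture.HodgeConjecture.Theorems.F0P3SpectralPacketRigidityOffS       -- ★-cand (LH7-typ1 (g3) D2′, 5636ff7b8c5eff12): the eleven `_offS` siblings, `(h4 : ∀ v ∉ S₀, (𝔩 v).UnramLaw)`
import Literature.NumberTheory.GaloisRepresentations.FrobeniusDensityTheorem                 -- ★ `finite_setOf_not_isUnramifiedIn` (only finitely many places of `L⁺` ramify in `L`)
import HarnessLib

/-!
# THE O3∕O5 CLOSERS UNDER THE HUR-GUARDED ROW (KG1′) — `xiRigidityGHom_of_marker_laws_of_core_of_isUnramifiedIn`, `xiRigidityH_of_KR_of_isUnramifiedIn`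
# (docket F13 «JQ-RAM», STANDING DEFECT M-159, (R-39)″; Rogawski §4.5 p. 49, §13.3 p. 203 l. 1–3, §13.7 p. 206, §13.8 p. 216 last ¶)

Cell `hodgecm-mathlib`, F0∕P3c line LH7 (leaf `Cruxes/H413/Lines/F0_P3c_PKtuplePaydown.lean` ED. 6 d04978fb87efb1ea, organ ties O3 `stub_PKrigidGOfCore` :713 ∕ O5 `stub_PKrigidHOfKR` :819),
crux H413 = `stmt-HodgeConjecture-24833`; typist LH7-typ1 (g3), default D2″; `--supports stmt-HodgeConjecture-24833`; closes no stub; companion of ★-cand `F0P3SpectralPacketRigidityOffS`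
(split off for the 400-line lint).

THE MATHEMATICS.  (R-39)″ (director s2025 (2), heir LEAD F0P3a-plan T21-09∕T21-10): the kit law (KG1) of `TupleKitLawsK2` is re-typed (KG1′) `∀ v : Places L, Algebra.IsUnramifiedIn (𝓞 L) v.asIdeal →
(𝔩 v).UnramLaw` — print reads (ℓ4) [Thm. 13.1.1 p. 198; p. 203 l. 1–3] only where `G_v` is unramified and `K_v` hyperspecial [§4.5 p. 49]; at a place of `L⁺` ramified in `L` a `K_v`-spherical
member pairs to `−1` with `ρ` [Prop. 13.1.3 (c) p. 199; §13.8 p. 216 last ¶] — and it «plugs BY NAME, no `hS` binder in T-A».  Off `S₀ ∪ RamL`, `RamL := (finite_setOf_not_isUnramifiedIn L⁺ L).toFinset`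
(the finitely many places of `L⁺` ramified in `L` — NOT the record's `ramOfRecord₂ ξ`, whose containment of `RamL` is semantic: LH7-audit1 (g2) CAUTION, LH7-typ2 (g2) PRECISION #2), (KG1′) gives
the unramified law, and the two organ closers conclude statements that do not mention `S₀`; so ★ `xiRigidityGHom_of_marker_laws_of_core` (p848182) and ★ `xiRigidityH_of_KR` (p848874) hold with
(KG1′) IN THE ARGUMENT SLOT OF (KG1), via the `_offS` siblings at the enlarged guard.  The leaf ED. 7 ties of O3∕O5 are then the ED. 6 ties with ONE TOKEN renamed each (`…_of_core` ↦
`…_of_core_of_isUnramifiedIn`, `…_of_KR` ↦ `…_of_KR_of_isUnramifiedIn`) — no letter binder, no threading.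

CONTENTS: `F0P3SpectralPacket.isUnramifiedIn_of_not_mem_ramifiedFinset` (membership in `Set.Finite.toFinset`, contrapositive), `SpectralPacketG.xiRigidityGHom_of_marker_laws_of_core_of_isUnramifiedIn`,
`SpectralPacketH.xiRigidityH_of_KR_of_isUnramifiedIn`.  No instance, no notation, no named fact, no new definition, no `sorry`.
HONEST LABEL: HC_CM is proved only modulo the 7 printed citations (2 remaining named inputs: hLiu418 = stmt-HodgeConjecture-24832, h413 = stmt-HodgeConjecture-24833) until rung 0 closes;
STANDING DEFECT M-159 «JQ-RAM» is carried until the F13 re-type is BUILT; this file proves no printed statement — it re-plugs in-house glue under the guarded row.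

References: [Rogawski1990] §4.5 p. 49; §13.1 Thm. 13.1.1 p. 198, Prop. 13.1.3 (c) p. 199; §13.3 Thms. 13.3.2∕13.3.4∕13.3.5∕13.3.6 (c) p. 202, p. 203 l. 1–3; §13.7 p. 206; §13.8 p. 216 last ¶.
[CartierCorvallis1979] §IV.1 Cor. 4.1.
-/

set_option autoImplicit false
-- the mandated namespace repeats `HodgeConjecture.HodgeConjecture`, as in every `Theorems/*.lean` of this sub-problem
set_option linter.dupNamespace false

noncomputable section

open NumberField IsDedekindDomain MeasureTheory Filter
open scoped Matrix MatrixGroups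

open Literature.NumberTheory Literature.NumberTheory.Automorphic Literature.NumberTheory.Automorphic.UnitaryGroup
open Literature.NumberTheory.Rogawski1990 Literature.NumberTheory.GaloisRepresentations
open Literature.RepresentationTheory.BorelWallach2000 Literature.RepresentationTheory.KonnoKonno2007
open Summit.HodgeConjecture.HodgeConjecture.Cruxes.H413.F0P3InnerFormClassificationV6 (splitForm EvpData EqOff)
open Summit.HodgeConjecture.HodgeConjecture.Cruxes.H413.F0P3LocalPacketKit
open Summit.HodgeConjecture.HodgeConjecture.Cruxes.H413.F0P3ArchPacketKit

/-! ## §1 The HUR-guarded closers: (KG1′) `∀ v, IsUnramifiedIn (𝓞 L) v ⇒ UnramLaw` in the slot of (KG1), read off `S₀ ∪ RamL` [§4.5 p. 49; §13.8 p. 216 last ¶; p. 203 l. 1–3] -/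

namespace Summit.HodgeConjecture.HodgeConjecture.Cruxes.H413.F0P3SpectralPacket

/-- **OFF THE RAMIFIED FINSET A PLACE IS UNRAMIFIED**: `v ∉ RamL := (finite_setOf_not_isUnramifiedIn L⁺ L).toFinset ⇒ v` is unramified in `L` (membership in `Set.Finite.toFinset`). [folklore]
[cite: Rogawski1990, §4.5 p. 49] -/
theorem isUnramifiedIn_of_not_mem_ramifiedFinset {L : Type} [Field L] [NumberField L] {v : HeightOneSpectrum (𝓞 ↥(maximalRealSubfield L))}
    (hv : v ∉ (Literature.NumberTheory.GaloisRepresentations.finite_setOf_not_isUnramifiedIn ↥(maximalRealSubfield L) L).toFinset) :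
    Algebra.IsUnramifiedIn (𝓞 L) v.asIdeal :=
  not_not.1 fun h => hv ((Set.Finite.mem_toFinset _).2 h)

end Summit.HodgeConjecture.HodgeConjecture.Cruxes.H413.F0P3SpectralPacket

namespace Summit.HodgeConjecture.HodgeConjecture.Cruxes.H413.F0P3SpectralPacket.SpectralPacketG

open Summit.HodgeConjecture.HodgeConjecture.Cruxes.H413.F0P3GlobalPacket

variable {L : Type} [Field L] [NumberField L] [IsCMField L] {H : Matrix (Fin 3) (Fin 3) L}
  {𝔩 : ∀ v : HeightOneSpectrum (𝓞 ↥(maximalRealSubfield L)), LocalPacketKit L (splitForm L 3) v} {𝔞 : ArchPacketKit}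
  {μ : Measure (adelicGroupData (↥(maximalRealSubfield L)) L (IsCMField.complexConj L) 3 (splitForm L 3)).automorphicQuotient}
  [SMulInvariantMeasure (adelicGroupData (↥(maximalRealSubfield L)) L (IsCMField.complexConj L) 3 (splitForm L 3)).Adelic
    (adelicGroupData (↥(maximalRealSubfield L)) L (IsCMField.complexConj L) 3 (splitForm L 3)).automorphicQuotient μ]
  [∀ v : HeightOneSpectrum (𝓞 ↥(maximalRealSubfield L)), MeasurableSpace ((cmDatum L 3 (splitForm L 3)).Local v)]
  [∀ v : HeightOneSpectrum (𝓞 ↥(maximalRealSubfield L)), BorelSpace ((cmDatum L 3 (splitForm L 3)).Local v)]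
  [∀ v : HeightOneSpectrum (𝓞 ↥(maximalRealSubfield L)), MeasurableSpace ((cmDatum L 3 H).Local v)]
  [∀ v : HeightOneSpectrum (𝓞 ↥(maximalRealSubfield L)), BorelSpace ((cmDatum L 3 H).Local v)]
  {νG' : ∀ v : HeightOneSpectrum (𝓞 ↥(maximalRealSubfield L)), Measure ((cmDatum L 3 H).Local v)}
  [∀ v, (νG' v).IsMulLeftInvariant] [∀ v, IsFiniteMeasureOnCompacts (νG' v)]
  {ψ : ∀ v : HeightOneSpectrum (𝓞 ↥(maximalRealSubfield L)), (cmDatum L 3 H).Local v ≃ₜ* (cmDatum L 3 (splitForm L 3)).Local v}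
  {Pk' : OneDimAutRepH L → ∀ v : HeightOneSpectrum (𝓞 ↥(maximalRealSubfield L)), CMLocalAPacket L H v}
  {ram : OneDimAutRepH L → Finset (HeightOneSpectrum (𝓞 ↥(maximalRealSubfield L)))}
  {infOf : GlobalPacket 𝔩 → 𝔞.PktInf} {aTok : ∀ v : HeightOneSpectrum (𝓞 ↥(maximalRealSubfield L)), Set (𝔩 v).Pkt}
  {PkInf : OneDimAutRepH L → LocalAPacket (GKIrrClass (uFormGroup (Fin 2) (Fin 1)))} {κ : OneDimAutRepH L → ℤ}

/-- **ORGAN O3, KIT-GENERIC, UNDER THE HUR-GUARDED ROW (KG1′): (L1″) `XiRigidityGHom`** — the argument list of ★ `xiRigidityGHom_of_marker_laws_of_core` (p848182) with (KG1) `∀ v, (𝔩 v).UnramLaw` replaced IN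
PLACE by (KG1′) `∀ v, Algebra.IsUnramifiedIn (𝓞 L) v.asIdeal → (𝔩 v).UnramLaw`; proof = `xiRigidityGHom_of_marker_laws_of_core_offS` at the guard `S₀ ∪ RamL`, `RamL` the finitely many places of `L⁺`
ramified in `L` (★ `finite_setOf_not_isUnramifiedIn`) — the conclusion does not mention `S₀`. The leaf ED. 7 tie of `stub_PKrigidGOfCore` is the ED. 6 tie with this one token renamed.
[cite: Rogawski1990, §13.3 Thm. 13.3.5 p. 202, Thm. 13.3.6 (c) p. 202, p. 203 l. 1–3; §13.7 p. 206; §4.5 p. 49; §13.8 p. 216] [cite: CartierCorvallis1979, §IV.1 Cor. 4.1] -/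
theorem xiRigidityGHom_of_marker_laws_of_core_of_isUnramifiedIn
    {h : XiPacketsSignedHom 𝔩 𝔞 μ infOf aTok (transportAPackets ψ Pk') PkInf κ}
    (hKM1 : ∀ (v : HeightOneSpectrum (𝓞 ↥(maximalRealSubfield L))) (P P' : (𝔩 v).Pkt), (𝔩 v).mem P = (𝔩 v).mem P' → (∀ c, (𝔩 v).one P c = (𝔩 v).one P' c) →
      (P ∈ aTok v ↔ P' ∈ aTok v) → P = P')
    (hKJ : ∀ (v : HeightOneSpectrum (𝓞 ↥(maximalRealSubfield L))) (P : (𝔩 v).Pkt) (c : IrrClass ((UnitaryGroup.cmDatum L 3 (splitForm L 3)).Local v)),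
      c ∉ (𝔩 v).mem P → (𝔩 v).one P c = 0)
    (hKM2 : ∀ (ξ : OneDimAutRepH L) (v : HeightOneSpectrum (𝓞 ↥(maximalRealSubfield L))) (P : (𝔩 v).Pkt), P ∉ aTok v →
      (transportAPackets ψ Pk' ξ v).πn ∉ (𝔩 v).mem P)
    (hKM3 : ∀ (ξ : OneDimAutRepH L) (v : HeightOneSpectrum (𝓞 ↥(maximalRealSubfield L))) (P : (𝔩 v).Pkt), P ∈ aTok v →
      ((transportAPackets ψ Pk' ξ v).πn ∈ (𝔩 v).mem P ∨ ∃ c, (transportAPackets ψ Pk' ξ v).πs = some c ∧ c ∈ (𝔩 v).mem P) →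
      (∀ c, c ∈ (𝔩 v).mem P ↔ (c = (transportAPackets ψ Pk' ξ v).πn ∨ (transportAPackets ψ Pk' ξ v).πs = some c)) ∧
        (𝔩 v).one P (transportAPackets ψ Pk' ξ v).πn = 1 ∧ ∀ c ∈ (𝔩 v).mem P, c ≠ (transportAPackets ψ Pk' ξ v).πn → (𝔩 v).one P c = -1)
    (h4 : ∀ v : HeightOneSpectrum (𝓞 ↥(maximalRealSubfield L)), Algebra.IsUnramifiedIn (𝓞 L) v.asIdeal → (𝔩 v).UnramLaw)
    (hKG3 : ∀ (v : HeightOneSpectrum (𝓞 ↥(maximalRealSubfield L))) (P : (𝔩 v).Pkt), ∀ π ∈ (𝔩 v).mem P, π.IsAdmissible)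
    (S₀ : Finset (HeightOneSpectrum (𝓞 ↥(maximalRealSubfield L))))
    (hψK : ∀ v ∉ S₀, (cmLocalIntegralLevel L 3 H v).map (ψ v : (cmDatum L 3 H).Local v →* (cmDatum L 3 (splitForm L 3)).Local v) =
      cmLocalIntegralLevel L 3 (splitForm L 3) v)
    (hvol : ∀ v : HeightOneSpectrum (𝓞 ↥(maximalRealSubfield L)), (νG' v).real (cmLocalIntegralLevel L 3 H v : Set ((cmDatum L 3 H).Local v)) ≠ 0)
    (hsph : ∀ (ξ : OneDimAutRepH L), ∀ v ∉ ram ξ, (Pk' ξ v).πn.IsSpherical (cmLocalIntegralLevel L 3 H v))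
    (hadmn : ∀ (ξ : OneDimAutRepH L) (v : HeightOneSpectrum (𝓞 ↥(maximalRealSubfield L))), (Pk' ξ v).πn.IsAdmissible)
    {tXi : OneDimAutRepH L → EvpData L H}
    (ht : ∀ (ξ : OneDimAutRepH L), ∀ v ∉ ram ξ, tXi ξ v = (Pk' ξ v).πn.eigencharacter (cmLocalIntegralLevel L 3 H v) (νG' v))
    (hcore : ∀ (ξ : OneDimAutRepH L) (π : ∀ v : HeightOneSpectrum (𝓞 ↥(maximalRealSubfield L)), IrrClass ((cmDatum L 3 (splitForm L 3)).Local v)),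
      F0P3GlobalPacketDiscrete.cmOccursInDiscreteSpectrum L 3 (splitForm L 3) μ π →
      (∀ᶠ v in cofinite, π v = (transportAPackets ψ Pk' ξ v).πn) →
      ∀ v, π v = (transportAPackets ψ Pk' ξ v).πn ∨ (transportAPackets ψ Pk' ξ v).πs = some (π v)) :
    XiRigidityGHom h ψ (fun w => (νG' w).map (ψ w)) tXi := by
  classical
  exact xiRigidityGHom_of_marker_laws_of_core_offS hKM1 hKJ hKM2 hKM3 hKG3
    (S₀ ∪ (Literature.NumberTheory.GaloisRepresentations.finite_setOf_not_isUnramifiedIn ↥(maximalRealSubfield L) L).toFinset)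
    (fun v hv => hψK v fun h' => hv (Finset.mem_union_left _ h'))
    (fun v hv => h4 v (isUnramifiedIn_of_not_mem_ramifiedFinset fun h' => hv (Finset.mem_union_right _ h'))) hvol hsph hadmn ht hcore

end Summit.HodgeConjecture.HodgeConjecture.Cruxes.H413.F0P3SpectralPacket.SpectralPacketG

namespace Summit.HodgeConjecture.HodgeConjecture.Cruxes.H413.F0P3SpectralPacket.SpectralPacketH

open Summit.HodgeConjecture.HodgeConjecture.Cruxes.H413.F0P3GlobalPacket

variable {L : Type} [Field L] [NumberField L] [IsCMField L] {H : Matrix (Fin 3) (Fin 3) L}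
  {𝔩 : ∀ v : HeightOneSpectrum (𝓞 ↥(maximalRealSubfield L)), LocalPacketKit L (splitForm L 3) v} {𝔞 : ArchPacketKit} {𝔞H : ArchPacketKitH 𝔞}
  {DiscH : GlobalPacketH 𝔩 → 𝔞H.PktInfH → Prop}
  [∀ v : HeightOneSpectrum (𝓞 ↥(maximalRealSubfield L)), MeasurableSpace ((cmDatum L 3 (splitForm L 3)).Local v)]
  [∀ v : HeightOneSpectrum (𝓞 ↥(maximalRealSubfield L)), BorelSpace ((cmDatum L 3 (splitForm L 3)).Local v)]
  [∀ v : HeightOneSpectrum (𝓞 ↥(maximalRealSubfield L)), MeasurableSpace ((cmDatum L 3 H).Local v)]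
  [∀ v : HeightOneSpectrum (𝓞 ↥(maximalRealSubfield L)), BorelSpace ((cmDatum L 3 H).Local v)]
  {νG' : ∀ v : HeightOneSpectrum (𝓞 ↥(maximalRealSubfield L)), Measure ((cmDatum L 3 H).Local v)}
  [∀ v, (νG' v).IsMulLeftInvariant] [∀ v, IsFiniteMeasureOnCompacts (νG' v)]
  {ψ : ∀ v : HeightOneSpectrum (𝓞 ↥(maximalRealSubfield L)), (cmDatum L 3 H).Local v ≃ₜ* (cmDatum L 3 (splitForm L 3)).Local v}
  {Pk' : OneDimAutRepH L → ∀ v : HeightOneSpectrum (𝓞 ↥(maximalRealSubfield L)), CMLocalAPacket L H v}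
  {ram : OneDimAutRepH L → Finset (HeightOneSpectrum (𝓞 ↥(maximalRealSubfield L)))}
  {PkInf : OneDimAutRepH L → LocalAPacket (GKIrrClass (uFormGroup (Fin 2) (Fin 1)))}
  {χ : OneDimAutRepH L → ∀ v : HeightOneSpectrum (𝓞 ↥(maximalRealSubfield L)),
    (UnitaryGroup.cmDatum L 2 (Matrix.of fun i j : Fin 2 => if i.val + j.val + 1 = 2 then (1 : L) else 0)).Local v ×
      (UnitaryGroup.cmDatum L 1 (Matrix.of fun i j : Fin 1 => if i.val + j.val + 1 = 1 then (1 : L) else 0)).Local v →* ℂˣ}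
  {hχ : ∀ (ξ : OneDimAutRepH L) (v : HeightOneSpectrum (𝓞 ↥(maximalRealSubfield L))),
    IsOpen (((χ ξ v).ker : Subgroup ((UnitaryGroup.cmDatum L 2 (Matrix.of fun i j : Fin 2 => if i.val + j.val + 1 = 2 then (1 : L) else 0)).Local v ×
      (UnitaryGroup.cmDatum L 1 (Matrix.of fun i j : Fin 1 => if i.val + j.val + 1 = 1 then (1 : L) else 0)).Local v)) :
      Set ((UnitaryGroup.cmDatum L 2 (Matrix.of fun i j : Fin 2 => if i.val + j.val + 1 = 2 then (1 : L) else 0)).Local v ×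
        (UnitaryGroup.cmDatum L 1 (Matrix.of fun i j : Fin 1 => if i.val + j.val + 1 = 1 then (1 : L) else 0)).Local v))}
  {ε : OneDimAutRepH L → HeightOneSpectrum (𝓞 ↥(maximalRealSubfield L)) → ℤ} {κH : OneDimAutRepH L → ℤ}

/-- **(L3) `XiRigidityH` FROM (KD1) + (KD3) + (KR-1) + (KR-2) UNDER THE HUR-GUARDED ROW (KG1′)** — the argument list of ★ `xiRigidityH_of_KR` (p848874) with (KG1) replaced IN PLACE by (KG1′)
`∀ v, Algebra.IsUnramifiedIn (𝓞 L) v.asIdeal → (𝔩 v).UnramLaw`; proof = `xiRigidityH_of_KR_offS` at the guard `S₀ ∪ RamL` (★ `finite_setOf_not_isUnramifiedIn`); the conclusion does not mention `S₀`.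
The leaf ED. 7 tie of `stub_PKrigidHOfKR` is the ED. 6 tie with this one token renamed. [cite: Rogawski1990, §13.3 Thm. 13.3.5 p. 202, Thms. 13.3.2∕13.3.4 p. 202, p. 203 l. 1–3; §13.7 p. 206; §4.5 p. 49;
§13.8 p. 216] [cite: CartierCorvallis1979, §IV.1 Cor. 4.1] -/
theorem xiRigidityH_of_KR_of_isUnramifiedIn {hH : XiHPacketsSigned 𝔩 𝔞 𝔞H DiscH (transportAPackets ψ Pk') PkInf χ hχ ε κH}
    (hKD1 : ∀ (v : HeightOneSpectrum (𝓞 ↥(maximalRealSubfield L))) (ρ ρ' : (𝔩 v).PktH), (𝔩 v).memH ρ = (𝔩 v).memH ρ' → ρ = ρ')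
    (hKD3 : ∀ (σ : GlobalPacketH 𝔩) (P P' : 𝔞H.PktInfH), DiscH σ P → DiscH σ P' → P = P')
    (hKR1 : ∀ (ξ : OneDimAutRepH L) (v : HeightOneSpectrum (𝓞 ↥(maximalRealSubfield L))) (r : (𝔩 v).PktH),
      (transportAPackets ψ Pk' ξ v).πn ∈ (𝔩 v).mem ((𝔩 v).xiH r) → (𝔩 v).memH r = {IrrClass.mk (SmoothIrrep.ofChar (χ ξ v) (hχ ξ v))})
    (hKR2 : ∀ (ρ : SpectralPacketH 𝔩 𝔞 𝔞H DiscH) (ξ : OneDimAutRepH L) (T : Finset (HeightOneSpectrum (𝓞 ↥(maximalRealSubfield L)))),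
      (∀ v ∉ T, (𝔩 v).memH (ρ.fin.loc v) = {IrrClass.mk (SmoothIrrep.ofChar (χ ξ v) (hχ ξ v))}) →
      ∀ v, (𝔩 v).memH (ρ.fin.loc v) = {IrrClass.mk (SmoothIrrep.ofChar (χ ξ v) (hχ ξ v))})
    (h4 : ∀ v : HeightOneSpectrum (𝓞 ↥(maximalRealSubfield L)), Algebra.IsUnramifiedIn (𝓞 L) v.asIdeal → (𝔩 v).UnramLaw)
    (hKG3 : ∀ (v : HeightOneSpectrum (𝓞 ↥(maximalRealSubfield L))) (P : (𝔩 v).Pkt), ∀ π ∈ (𝔩 v).mem P, π.IsAdmissible)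
    (S₀ : Finset (HeightOneSpectrum (𝓞 ↥(maximalRealSubfield L))))
    (hψK : ∀ v ∉ S₀, (cmLocalIntegralLevel L 3 H v).map (ψ v : (cmDatum L 3 H).Local v →* (cmDatum L 3 (splitForm L 3)).Local v) =
      cmLocalIntegralLevel L 3 (splitForm L 3) v)
    (hvol : ∀ v : HeightOneSpectrum (𝓞 ↥(maximalRealSubfield L)), (νG' v).real (cmLocalIntegralLevel L 3 H v : Set ((cmDatum L 3 H).Local v)) ≠ 0)
    (hsph : ∀ (ξ : OneDimAutRepH L), ∀ v ∉ ram ξ, (Pk' ξ v).πn.IsSpherical (cmLocalIntegralLevel L 3 H v))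
    (hadmn : ∀ (ξ : OneDimAutRepH L) (v : HeightOneSpectrum (𝓞 ↥(maximalRealSubfield L))), (Pk' ξ v).πn.IsAdmissible)
    {tXi : OneDimAutRepH L → EvpData L H}
    (ht : ∀ (ξ : OneDimAutRepH L), ∀ v ∉ ram ξ, tXi ξ v = (Pk' ξ v).πn.eigencharacter (cmLocalIntegralLevel L 3 H v) (νG' v)) :
    XiRigidityH hH ψ (fun w => (νG' w).map (ψ w)) tXi := by
  classical
  exact xiRigidityH_of_KR_offS hKD1 hKD3 hKR1 hKR2 hKG3
    (S₀ ∪ (Literature.NumberTheory.GaloisRepresentations.finite_setOf_not_isUnramifiedIn ↥(maximalRealSubfield L) L).toFinset)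
    (fun v hv => hψK v fun h' => hv (Finset.mem_union_left _ h'))
    (fun v hv => h4 v (isUnramifiedIn_of_not_mem_ramifiedFinset fun h' => hv (Finset.mem_union_right _ h'))) hvol hsph hadmn ht

end Summit.HodgeConjecture.HodgeConjecture.Cruxes.H413.F0P3SpectralPacket.SpectralPacketH

end
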